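import Summits.CriticalPhenomena.PercolationContinuityZ3.Theorems.PercNearOneGluingNoHeavyLowerTailPortCubePhi4Line
import Summits.CriticalPhenomena.PercolationContinuityZ3.Theorems.PercNearOneGluingNoHeavyLowerTailSuperTerminalPortBasics
import HarnessLib

/-!
# THEOREM R, the line package: `Φ₄ − C` along one cube pair, as a function of the pair weight

Support file for crux `stmt-CriticalPhenomena-4575` (`NoHeavyLowerTail`), seat `prim-l12-p1` gen 26 (`--supports stmt-CriticalPhenomena-4575`);
memo `run/shared/lean/prim/prim-l12/FROM-prim-l12-p1-g26-THEOREM-R-KERNEL.md` §6.  No definitions, no sorries, standard axioms.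
Setting of `…SuperTerminalPortPairs` (`Q, A, B, C` the super-terminal coordinates of `μ_w = prodBernoulli w` for root `s`, block partner `a`,
singleton `b`, port `c`).  For a weight function `w'`, a pair `e` with `w' e = t₀ ∈ (0,1)`, `Q(w') > 0`, `B(w') > 0`, and any parametrisation
`Wl : ℝ → weights` with `Wl t = w'[e ↦ t]` for `t ∈ [0,1]`, the line function `t ↦ Q(Wl t)⁴/(A(Wl t)² B(Wl t)²) − C(Wl t)`:
* `line_hasDerivAt` — is differentiable at `t₀` with derivative `Φ₄(w')·(−4X̂ + 2Â + 2B̂) + (C₀ − C₁)` (decrements `X̂ = (Q₀ − Q₁)/Q(w')`, …, endpoint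
  values `Q₀ = Q(w'[e↦0])`, `Q₁ = Q(w'[e↦1])`, …; affinity `SuperTerminalPortBasics.real_update_sub` + `PortCubePhi4Line.hasDerivAt_Phi4Line`);
* `line_direction` — if moreover `KEY₄ = 4(3X̂ − Ŝ)(X̂ − Ŝ) + 2(Â² + B̂²) ≥ 0` then it admits a derivative function near `t₀` differentiable at `t₀` with
  derivative `≥ 0` (`PortCubePhi4Line.phi4Line_direction`) — the `hdir` package of the cube maximum principles `…PortCubeMaxPrinciple(Critical)`.
Used by `…SuperTerminalQuarticOfCritical` (THEOREM R in minimal-counterexample form).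
-/

namespace Summit.CriticalPhenomena.PercolationContinuityZ3.Theorems.SuperTerminalQuarticLine

open MeasureTheory Set Filter Topology Real
open Literature.Probability.Percolation Literature.Probability.LatticeModels
open Summit.CriticalPhenomena.PercolationContinuityZ3.Theorems
open Summit.CriticalPhenomena.PercolationContinuityZ3.Theorems.SuperTerminalPortBasics
open scoped Classical

variable {V : Type*} [Fintype V]

/-- **The line function along a cube pair equals the `Φ₄`-line of `PortCubePhi4Line` near `t₀`, and its derivative there.**
See the module docstring. [this work] -/
theorem line_hasDerivAt (w' : Sym2 V → unitInterval) (s a b c : V) (e : Sym2 V) (Wl : ℝ → (Sym2 V → unitInterval)) {t₀ : ℝ}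
    (ht₀ : t₀ ∈ Ioo (0 : ℝ) 1) (hWl : ∀ t ∈ Icc (0 : ℝ) 1, Wl t = Function.update w' e (Set.projIcc (0 : ℝ) 1 zero_le_one t))
    (he : (w' e : ℝ) = t₀)
    (hQ : 0 < (prodBernoulli w').real (openConn s a ∩ (openConn s b)ᶜ ∩ ((openConn c s)ᶜ ∩ (openConn c a)ᶜ ∩ (openConn c b)ᶜ) : Set (BondConfig V)))
    (hB : 0 < (prodBernoulli w').real (openConn s a ∩ (openConn s b)ᶜ ∩ (openConn c b)ᶜ : Set (BondConfig V))) :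
    ((fun t => (prodBernoulli (Wl t)).real (openConn s a ∩ (openConn s b)ᶜ ∩ ((openConn c s)ᶜ ∩ (openConn c a)ᶜ ∩ (openConn c b)ᶜ) : Set (BondConfig V)) ^ 4 /
          ((prodBernoulli (Wl t)).real (openConn s a ∩ (openConn s b)ᶜ ∩ ((openConn c s)ᶜ ∩ (openConn c a)ᶜ) : Set (BondConfig V)) ^ 2 *
            (prodBernoulli (Wl t)).real (openConn s a ∩ (openConn s b)ᶜ ∩ (openConn c b)ᶜ : Set (BondConfig V)) ^ 2) -
          (prodBernoulli (Wl t)).real ((openConn c s)ᶜ ∩ (openConn c a)ᶜ ∩ (openConn c b)ᶜ : Set (BondConfig V))) =ᶠ[𝓝 t₀]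
      fun t => exp (4 * log ((prodBernoulli (Function.update w' e 0)).real (openConn s a ∩ (openConn s b)ᶜ ∩ ((openConn c s)ᶜ ∩ (openConn c a)ᶜ ∩ (openConn c b)ᶜ) : Set (BondConfig V)) -
            t * ((prodBernoulli (Function.update w' e 0)).real (openConn s a ∩ (openConn s b)ᶜ ∩ ((openConn c s)ᶜ ∩ (openConn c a)ᶜ ∩ (openConn c b)ᶜ) : Set (BondConfig V)) -
              (prodBernoulli (Function.update w' e 1)).real (openConn s a ∩ (openConn s b)ᶜ ∩ ((openConn c s)ᶜ ∩ (openConn c a)ᶜ ∩ (openConn c b)ᶜ) : Set (BondConfig V)))) -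
          2 * log ((prodBernoulli (Function.update w' e 0)).real (openConn s a ∩ (openConn s b)ᶜ ∩ ((openConn c s)ᶜ ∩ (openConn c a)ᶜ) : Set (BondConfig V)) -
            t * ((prodBernoulli (Function.update w' e 0)).real (openConn s a ∩ (openConn s b)ᶜ ∩ ((openConn c s)ᶜ ∩ (openConn c a)ᶜ) : Set (BondConfig V)) -
              (prodBernoulli (Function.update w' e 1)).real (openConn s a ∩ (openConn s b)ᶜ ∩ ((openConn c s)ᶜ ∩ (openConn c a)ᶜ) : Set (BondConfig V)))) -
          2 * log ((prodBernoulli (Function.update w' e 0)).real (openConn s a ∩ (openConn s b)ᶜ ∩ (openConn c b)ᶜ : Set (BondConfig V)) -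
            t * ((prodBernoulli (Function.update w' e 0)).real (openConn s a ∩ (openConn s b)ᶜ ∩ (openConn c b)ᶜ : Set (BondConfig V)) -
              (prodBernoulli (Function.update w' e 1)).real (openConn s a ∩ (openConn s b)ᶜ ∩ (openConn c b)ᶜ : Set (BondConfig V))))) -
        ((prodBernoulli (Function.update w' e 0)).real ((openConn c s)ᶜ ∩ (openConn c a)ᶜ ∩ (openConn c b)ᶜ : Set (BondConfig V)) -
          t * ((prodBernoulli (Function.update w' e 0)).real ((openConn c s)ᶜ ∩ (openConn c a)ᶜ ∩ (openConn c b)ᶜ : Set (BondConfig V)) -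
            (prodBernoulli (Function.update w' e 1)).real ((openConn c s)ᶜ ∩ (openConn c a)ᶜ ∩ (openConn c b)ᶜ : Set (BondConfig V))))) ∧
    HasDerivAt (fun t => (prodBernoulli (Wl t)).real (openConn s a ∩ (openConn s b)ᶜ ∩ ((openConn c s)ᶜ ∩ (openConn c a)ᶜ ∩ (openConn c b)ᶜ) : Set (BondConfig V)) ^ 4 /
          ((prodBernoulli (Wl t)).real (openConn s a ∩ (openConn s b)ᶜ ∩ ((openConn c s)ᶜ ∩ (openConn c a)ᶜ) : Set (BondConfig V)) ^ 2 *
            (prodBernoulli (Wl t)).real (openConn s a ∩ (openConn s b)ᶜ ∩ (openConn c b)ᶜ : Set (BondConfig V)) ^ 2) -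
          (prodBernoulli (Wl t)).real ((openConn c s)ᶜ ∩ (openConn c a)ᶜ ∩ (openConn c b)ᶜ : Set (BondConfig V)))
      ((prodBernoulli w').real (openConn s a ∩ (openConn s b)ᶜ ∩ ((openConn c s)ᶜ ∩ (openConn c a)ᶜ ∩ (openConn c b)ᶜ) : Set (BondConfig V)) ^ 4 /
          ((prodBernoulli w').real (openConn s a ∩ (openConn s b)ᶜ ∩ ((openConn c s)ᶜ ∩ (openConn c a)ᶜ) : Set (BondConfig V)) ^ 2 *
            (prodBernoulli w').real (openConn s a ∩ (openConn s b)ᶜ ∩ (openConn c b)ᶜ : Set (BondConfig V)) ^ 2) *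
          (4 * (-((prodBernoulli (Function.update w' e 0)).real (openConn s a ∩ (openConn s b)ᶜ ∩ ((openConn c s)ᶜ ∩ (openConn c a)ᶜ ∩ (openConn c b)ᶜ) : Set (BondConfig V)) -
                  (prodBernoulli (Function.update w' e 1)).real (openConn s a ∩ (openConn s b)ᶜ ∩ ((openConn c s)ᶜ ∩ (openConn c a)ᶜ ∩ (openConn c b)ᶜ) : Set (BondConfig V))) /
                (prodBernoulli w').real (openConn s a ∩ (openConn s b)ᶜ ∩ ((openConn c s)ᶜ ∩ (openConn c a)ᶜ ∩ (openConn c b)ᶜ) : Set (BondConfig V))) -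
            2 * (-((prodBernoulli (Function.update w' e 0)).real (openConn s a ∩ (openConn s b)ᶜ ∩ ((openConn c s)ᶜ ∩ (openConn c a)ᶜ) : Set (BondConfig V)) -
                  (prodBernoulli (Function.update w' e 1)).real (openConn s a ∩ (openConn s b)ᶜ ∩ ((openConn c s)ᶜ ∩ (openConn c a)ᶜ) : Set (BondConfig V))) /
                (prodBernoulli w').real (openConn s a ∩ (openConn s b)ᶜ ∩ ((openConn c s)ᶜ ∩ (openConn c a)ᶜ) : Set (BondConfig V))) -
            2 * (-((prodBernoulli (Function.update w' e 0)).real (openConn s a ∩ (openConn s b)ᶜ ∩ (openConn c b)ᶜ : Set (BondConfig V)) -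
                  (prodBernoulli (Function.update w' e 1)).real (openConn s a ∩ (openConn s b)ᶜ ∩ (openConn c b)ᶜ : Set (BondConfig V))) /
                (prodBernoulli w').real (openConn s a ∩ (openConn s b)ᶜ ∩ (openConn c b)ᶜ : Set (BondConfig V)))) +
        ((prodBernoulli (Function.update w' e 0)).real ((openConn c s)ᶜ ∩ (openConn c a)ᶜ ∩ (openConn c b)ᶜ : Set (BondConfig V)) -
          (prodBernoulli (Function.update w' e 1)).real ((openConn c s)ᶜ ∩ (openConn c a)ᶜ ∩ (openConn c b)ᶜ : Set (BondConfig V)))) t₀ := by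
  set EQ : Set (BondConfig V) := openConn s a ∩ (openConn s b)ᶜ ∩ ((openConn c s)ᶜ ∩ (openConn c a)ᶜ ∩ (openConn c b)ᶜ) with hEQ
  set EA : Set (BondConfig V) := openConn s a ∩ (openConn s b)ᶜ ∩ ((openConn c s)ᶜ ∩ (openConn c a)ᶜ) with hEA
  set EB : Set (BondConfig V) := openConn s a ∩ (openConn s b)ᶜ ∩ (openConn c b)ᶜ with hEB
  set EC : Set (BondConfig V) := (openConn c s)ᶜ ∩ (openConn c a)ᶜ ∩ (openConn c b)ᶜ with hEC
  set q₀ := (prodBernoulli (Function.update w' e 0)).real EQ with hq₀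
  set q₁ := (prodBernoulli (Function.update w' e 1)).real EQ with hq₁
  set a₀ := (prodBernoulli (Function.update w' e 0)).real EA with ha₀
  set a₁ := (prodBernoulli (Function.update w' e 1)).real EA with ha₁
  set b₀ := (prodBernoulli (Function.update w' e 0)).real EB with hb₀
  set b₁ := (prodBernoulli (Function.update w' e 1)).real EB with hb₁
  set c₀ := (prodBernoulli (Function.update w' e 0)).real EC with hc₀
  set c₁ := (prodBernoulli (Function.update w' e 1)).real EC with hc₁
  -- affinity at `w'` (weight `t₀` on `e`) and along the line
  have aff : ∀ (t : unitInterval) (E : Set (BondConfig V)), (prodBernoulli (Function.update w' e t)).real E =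
      (prodBernoulli (Function.update w' e 0)).real E - (t : ℝ) * ((prodBernoulli (Function.update w' e 0)).real E -
        (prodBernoulli (Function.update w' e 1)).real E) := fun t E => real_update_sub w' e t E
  have aff0 : ∀ E : Set (BondConfig V), (prodBernoulli w').real E =
      (prodBernoulli (Function.update w' e 0)).real E - t₀ * ((prodBernoulli (Function.update w' e 0)).real E -
        (prodBernoulli (Function.update w' e 1)).real E) := by
    intro E
    have h := real_eq_update_sub w' e E
    rwa [he] at h
  have eQ : (prodBernoulli w').real EQ = q₀ - t₀ * (q₀ - q₁) := aff0 EQ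
  have eA : (prodBernoulli w').real EA = a₀ - t₀ * (a₀ - a₁) := aff0 EA
  have eB : (prodBernoulli w').real EB = b₀ - t₀ * (b₀ - b₁) := aff0 EB
  have hp1 : 0 < q₀ - t₀ * (q₀ - q₁) := by rw [← eQ]; exact hQ
  have hp2 : 0 < a₀ - t₀ * (a₀ - a₁) := by rw [← eA]; exact lt_of_lt_of_le hQ (coords_mono w' s a b c).2.1
  have hp3 : 0 < b₀ - t₀ * (b₀ - b₁) := by rw [← eB]; exact hB
  -- local equality of the two line functions
  have heq : (fun t => (prodBernoulli (Wl t)).real EQ ^ 4 / ((prodBernoulli (Wl t)).real EA ^ 2 * (prodBernoulli (Wl t)).real EB ^ 2) -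
        (prodBernoulli (Wl t)).real EC) =ᶠ[𝓝 t₀]
      fun t => exp (4 * log (q₀ - t * (q₀ - q₁)) - 2 * log (a₀ - t * (a₀ - a₁)) - 2 * log (b₀ - t * (b₀ - b₁))) - (c₀ - t * (c₀ - c₁)) := by
    have hnhd : Ioo (0 : ℝ) 1 ∈ 𝓝 t₀ := Ioo_mem_nhds ht₀.1 ht₀.2
    filter_upwards [hnhd, PortCubePhi4Line.eventually_pos3 hp1 hp2 hp3] with t ht hpos
    obtain ⟨pt1, pt2, pt3⟩ := hpos
    have ht' : t ∈ Icc (0 : ℝ) 1 := ⟨ht.1.le, ht.2.le⟩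
    have eXt : ∀ E : Set (BondConfig V), (prodBernoulli (Wl t)).real E = (prodBernoulli (Function.update w' e 0)).real E -
        t * ((prodBernoulli (Function.update w' e 0)).real E - (prodBernoulli (Function.update w' e 1)).real E) := by
      intro E; rw [hWl t ht', Set.projIcc_of_mem _ ht']; exact aff ⟨t, ht'⟩ E
    rw [eXt EQ, eXt EA, eXt EB, eXt EC, ← hq₀, ← hq₁, ← ha₀, ← ha₁, ← hb₀, ← hb₁, ← hc₀, ← hc₁, PortCubePhi4Line.exp_phi4_eq pt1 pt2 pt3]
  refine ⟨heq, ?_⟩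
  -- the derivative at `t₀`
  have hder := (PortCubePhi4Line.hasDerivAt_Phi4Line (c₀ := c₀) (dc := c₀ - c₁) hp1 hp2 hp3).self_of_nhds
  rw [PortCubePhi4Line.exp_phi4_eq hp1 hp2 hp3, ← eQ, ← eA, ← eB] at hder
  exact hder.congr_of_eventuallyEq heq

/-- **The convex-direction package along a cube pair from `KEY₄ ≥ 0`.**  See the module docstring. [this work] -/
theorem line_direction (w' : Sym2 V → unitInterval) (s a b c : V) (e : Sym2 V) (Wl : ℝ → (Sym2 V → unitInterval)) {t₀ : ℝ}
    (ht₀ : t₀ ∈ Ioo (0 : ℝ) 1) (hWl : ∀ t ∈ Icc (0 : ℝ) 1, Wl t = Function.update w' e (Set.projIcc (0 : ℝ) 1 zero_le_one t))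
    (he : (w' e : ℝ) = t₀)
    (hQ : 0 < (prodBernoulli w').real (openConn s a ∩ (openConn s b)ᶜ ∩ ((openConn c s)ᶜ ∩ (openConn c a)ᶜ ∩ (openConn c b)ᶜ) : Set (BondConfig V)))
    (hB : 0 < (prodBernoulli w').real (openConn s a ∩ (openConn s b)ᶜ ∩ (openConn c b)ᶜ : Set (BondConfig V)))
    (hkey : 0 ≤ 4 * (3 * (((prodBernoulli (Function.update w' e 0)).real (openConn s a ∩ (openConn s b)ᶜ ∩ ((openConn c s)ᶜ ∩ (openConn c a)ᶜ ∩ (openConn c b)ᶜ) : Set (BondConfig V)) -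
              (prodBernoulli (Function.update w' e 1)).real (openConn s a ∩ (openConn s b)ᶜ ∩ ((openConn c s)ᶜ ∩ (openConn c a)ᶜ ∩ (openConn c b)ᶜ) : Set (BondConfig V))) /
            (prodBernoulli w').real (openConn s a ∩ (openConn s b)ᶜ ∩ ((openConn c s)ᶜ ∩ (openConn c a)ᶜ ∩ (openConn c b)ᶜ) : Set (BondConfig V)))
          - (((prodBernoulli (Function.update w' e 0)).real (openConn s a ∩ (openConn s b)ᶜ ∩ ((openConn c s)ᶜ ∩ (openConn c a)ᶜ) : Set (BondConfig V)) -
                (prodBernoulli (Function.update w' e 1)).real (openConn s a ∩ (openConn s b)ᶜ ∩ ((openConn c s)ᶜ ∩ (openConn c a)ᶜ) : Set (BondConfig V))) /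
              (prodBernoulli w').real (openConn s a ∩ (openConn s b)ᶜ ∩ ((openConn c s)ᶜ ∩ (openConn c a)ᶜ) : Set (BondConfig V)) +
             ((prodBernoulli (Function.update w' e 0)).real (openConn s a ∩ (openConn s b)ᶜ ∩ (openConn c b)ᶜ : Set (BondConfig V)) -
                (prodBernoulli (Function.update w' e 1)).real (openConn s a ∩ (openConn s b)ᶜ ∩ (openConn c b)ᶜ : Set (BondConfig V))) /
              (prodBernoulli w').real (openConn s a ∩ (openConn s b)ᶜ ∩ (openConn c b)ᶜ : Set (BondConfig V))))
        * (((prodBernoulli (Function.update w' e 0)).real (openConn s a ∩ (openConn s b)ᶜ ∩ ((openConn c s)ᶜ ∩ (openConn c a)ᶜ ∩ (openConn c b)ᶜ) : Set (BondConfig V)) -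
              (prodBernoulli (Function.update w' e 1)).real (openConn s a ∩ (openConn s b)ᶜ ∩ ((openConn c s)ᶜ ∩ (openConn c a)ᶜ ∩ (openConn c b)ᶜ) : Set (BondConfig V))) /
            (prodBernoulli w').real (openConn s a ∩ (openConn s b)ᶜ ∩ ((openConn c s)ᶜ ∩ (openConn c a)ᶜ ∩ (openConn c b)ᶜ) : Set (BondConfig V))
          - (((prodBernoulli (Function.update w' e 0)).real (openConn s a ∩ (openConn s b)ᶜ ∩ ((openConn c s)ᶜ ∩ (openConn c a)ᶜ) : Set (BondConfig V)) -
                (prodBernoulli (Function.update w' e 1)).real (openConn s a ∩ (openConn s b)ᶜ ∩ ((openConn c s)ᶜ ∩ (openConn c a)ᶜ) : Set (BondConfig V))) /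
              (prodBernoulli w').real (openConn s a ∩ (openConn s b)ᶜ ∩ ((openConn c s)ᶜ ∩ (openConn c a)ᶜ) : Set (BondConfig V)) +
             ((prodBernoulli (Function.update w' e 0)).real (openConn s a ∩ (openConn s b)ᶜ ∩ (openConn c b)ᶜ : Set (BondConfig V)) -
                (prodBernoulli (Function.update w' e 1)).real (openConn s a ∩ (openConn s b)ᶜ ∩ (openConn c b)ᶜ : Set (BondConfig V))) /
              (prodBernoulli w').real (openConn s a ∩ (openConn s b)ᶜ ∩ (openConn c b)ᶜ : Set (BondConfig V)))) +
        2 * ((((prodBernoulli (Function.update w' e 0)).real (openConn s a ∩ (openConn s b)ᶜ ∩ ((openConn c s)ᶜ ∩ (openConn c a)ᶜ) : Set (BondConfig V)) -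
                (prodBernoulli (Function.update w' e 1)).real (openConn s a ∩ (openConn s b)ᶜ ∩ ((openConn c s)ᶜ ∩ (openConn c a)ᶜ) : Set (BondConfig V))) /
              (prodBernoulli w').real (openConn s a ∩ (openConn s b)ᶜ ∩ ((openConn c s)ᶜ ∩ (openConn c a)ᶜ) : Set (BondConfig V))) ^ 2 +
             (((prodBernoulli (Function.update w' e 0)).real (openConn s a ∩ (openConn s b)ᶜ ∩ (openConn c b)ᶜ : Set (BondConfig V)) -
                (prodBernoulli (Function.update w' e 1)).real (openConn s a ∩ (openConn s b)ᶜ ∩ (openConn c b)ᶜ : Set (BondConfig V))) /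
              (prodBernoulli w').real (openConn s a ∩ (openConn s b)ᶜ ∩ (openConn c b)ᶜ : Set (BondConfig V))) ^ 2)) :
    ∃ g' : ℝ → ℝ, ∃ D : ℝ, 0 ≤ D ∧
      (∀ᶠ t in 𝓝 t₀, HasDerivAt (fun t => (prodBernoulli (Wl t)).real (openConn s a ∩ (openConn s b)ᶜ ∩ ((openConn c s)ᶜ ∩ (openConn c a)ᶜ ∩ (openConn c b)ᶜ) : Set (BondConfig V)) ^ 4 /
          ((prodBernoulli (Wl t)).real (openConn s a ∩ (openConn s b)ᶜ ∩ ((openConn c s)ᶜ ∩ (openConn c a)ᶜ) : Set (BondConfig V)) ^ 2 *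
            (prodBernoulli (Wl t)).real (openConn s a ∩ (openConn s b)ᶜ ∩ (openConn c b)ᶜ : Set (BondConfig V)) ^ 2) -
          (prodBernoulli (Wl t)).real ((openConn c s)ᶜ ∩ (openConn c a)ᶜ ∩ (openConn c b)ᶜ : Set (BondConfig V))) (g' t) t) ∧
      HasDerivAt g' D t₀ := by
  set EQ : Set (BondConfig V) := openConn s a ∩ (openConn s b)ᶜ ∩ ((openConn c s)ᶜ ∩ (openConn c a)ᶜ ∩ (openConn c b)ᶜ) with hEQ
  set EA : Set (BondConfig V) := openConn s a ∩ (openConn s b)ᶜ ∩ ((openConn c s)ᶜ ∩ (openConn c a)ᶜ) with hEA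
  set EB : Set (BondConfig V) := openConn s a ∩ (openConn s b)ᶜ ∩ (openConn c b)ᶜ with hEB
  set EC : Set (BondConfig V) := (openConn c s)ᶜ ∩ (openConn c a)ᶜ ∩ (openConn c b)ᶜ with hEC
  set q₀ := (prodBernoulli (Function.update w' e 0)).real EQ with hq₀
  set q₁ := (prodBernoulli (Function.update w' e 1)).real EQ with hq₁
  set a₀ := (prodBernoulli (Function.update w' e 0)).real EA with ha₀
  set a₁ := (prodBernoulli (Function.update w' e 1)).real EA with ha₁
  set b₀ := (prodBernoulli (Function.update w' e 0)).real EB with hb₀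
  set b₁ := (prodBernoulli (Function.update w' e 1)).real EB with hb₁
  set c₀ := (prodBernoulli (Function.update w' e 0)).real EC with hc₀
  set c₁ := (prodBernoulli (Function.update w' e 1)).real EC with hc₁
  obtain ⟨heq, -⟩ := line_hasDerivAt w' s a b c e Wl ht₀ hWl he hQ hB
  have aff0 : ∀ E : Set (BondConfig V), (prodBernoulli w').real E =
      (prodBernoulli (Function.update w' e 0)).real E - t₀ * ((prodBernoulli (Function.update w' e 0)).real E -
        (prodBernoulli (Function.update w' e 1)).real E) := by
    intro E
    have h := real_eq_update_sub w' e E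
    rwa [he] at h
  have eQ : (prodBernoulli w').real EQ = q₀ - t₀ * (q₀ - q₁) := aff0 EQ
  have eA : (prodBernoulli w').real EA = a₀ - t₀ * (a₀ - a₁) := aff0 EA
  have eB : (prodBernoulli w').real EB = b₀ - t₀ * (b₀ - b₁) := aff0 EB
  have hp1 : 0 < q₀ - t₀ * (q₀ - q₁) := by rw [← eQ]; exact hQ
  have hp2 : 0 < a₀ - t₀ * (a₀ - a₁) := by rw [← eA]; exact lt_of_lt_of_le hQ (coords_mono w' s a b c).2.1
  have hp3 : 0 < b₀ - t₀ * (b₀ - b₁) := by rw [← eB]; exact hB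
  have hkey' : 0 ≤ (4 * (-(q₀ - q₁) / (q₀ - t₀ * (q₀ - q₁))) - 2 * (-(a₀ - a₁) / (a₀ - t₀ * (a₀ - a₁))) -
      2 * (-(b₀ - b₁) / (b₀ - t₀ * (b₀ - b₁)))) ^ 2 + (4 * (-(q₀ - q₁) ^ 2 / (q₀ - t₀ * (q₀ - q₁)) ^ 2) -
      2 * (-(a₀ - a₁) ^ 2 / (a₀ - t₀ * (a₀ - a₁)) ^ 2) - 2 * (-(b₀ - b₁) ^ 2 / (b₀ - t₀ * (b₀ - b₁)) ^ 2)) := by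
    rw [PortCubePhi4Line.key4_of_decrements, ← eQ, ← eA, ← eB]
    exact hkey
  obtain ⟨g', D, hD, hgd, hgD⟩ := PortCubePhi4Line.phi4Line_direction (c₀ := c₀) (dc := c₀ - c₁) hp1 hp2 hp3 hkey'
  refine ⟨g', D, hD, ?_, hgD⟩
  have heq' := eventually_eventuallyEq_nhds.2 heq
  filter_upwards [hgd, heq'] with t hderiv hloc
  exact hderiv.congr_of_eventuallyEq hloc

end Summit.CriticalPhenomena.PercolationContinuityZ3.Theorems.SuperTerminalQuarticLine
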